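import Mathlib
import HarnessLib
import Summits.Langlands.Langlands.Theses.ParityBlindBianchi
import Summits.Langlands.Langlands.Theses.RuelleTorsionArtinWeight
import Summits.Langlands.Langlands.Theorems.ParityBlindBianchiArtinWeightRealisationLevelLevelToAE
import Summits.Langlands.Langlands.Theorems.ParityBlindBianchiArtinWeightRealisationLevelRigidity
import Literature.NumberTheory.Automorphic.GLnAdelicStructureProofs

/-!
# R′ from R: `ParityBlindBianchi.ArtinWeightRealisationLevel` (crux stmt-Langlands-15111) modulo the
shared a.e. crux `RuelleTorsionArtinWeight.ArtinWeightRealisation` (stmt-Langlands-11057) —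
line `Sketch` (idea every-place-by-gamma-rigidity), lead composition (`--supports`)

The route-local crux R′ differs from the shared crux R in exactly two coordinates: (i) its
hypothesis pins the tame level by a finite set of rational primes `S₀ ∋ p` and asks Hansen
association at every good place (R: some finite set `S` of places); (ii) its conclusion asks
Satake–Frobenius compatibility at EVERY good place (R: at all but finitely many places).
(i) is the level bookkeeping `levelToAE` (landed, `…LevelToAE`); (ii) is the rigidity of a.e.
matching against a finite-image `σ` (landed, `…Rigidity`:
`satakeFrobCompatibleAt_of_eventually_of_isUnramifiedAt`), which rests on the σ-unramified shadow of
Gelbart 1997 Prop. 4.1 — taken here as the hypothesis `hG` written out (vendored separately as the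
Literature named fact `frobSatakeCompatibleAt_of_isPiOfArtinRep_of_isUnramifiedAt`); unramifiedness
of `σ` at a good place is part of the association hypothesis (`IsHeckeAssociatedAt.isUnramifiedAt`).
There is a third, purely typing, coordinate: `S₀ : Finset ℕ` may contain `0`, and then NO place is
good (`(0 : 𝓞 K)` lies in every prime), the hypothesis of R′ is idle and its conclusion is the bare
existence of a cuspidal automorphic representation of `GL₂(𝔸_K)` — the hypothesis `hC` written out
(vendored separately as the named fact `nonempty_cuspidalAutomorphicRepData_two`, Gelbart 1975
Thm. 7.11 / Jacquet–Langlands §12; no cusp form on `GL₂` over `K ≠ ℚ` exists in the tree).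

* `artinWeightRealisationLevel_of_artinWeightRealisation` : `R → hG → hC → R′` — the crux BY NAME
  modulo item 11057 and the two classical facts;
* `satakeFrobCompatibleAt_of_artinWeightRealisation_of_zero_not_mem` : `R → hG →` (the body of R′
  with `0 ∉ S₀`) — the same without the cusp-form existence hypothesis, for the intended
  (non-degenerate) sector; this is what a restatement of R′ with `0 ∉ S₀` (or `S₀ ⊆` primes) needs.

Honest ceiling of the line: R′ is closed MODULO item stmt-Langlands-11057 (the shared open crux,
the non-regular-weight wall); nothing else stands between R and R′.  No definitions.
-/

noncomputable section

open scoped BigOperators Topology Classical Matrix NumberField MatrixGroups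
open Literature.NumberTheory.Automorphic Literature.NumberTheory.GaloisRepresentations
  IsDedekindDomain NumberField Filter

-- `Summit.Langlands.Langlands.…`: summit = sub-problem name (D-0017 nested layout), not a typo.
set_option linter.dupNamespace false

namespace Summit.Langlands.Langlands.Theorems.ArtinWeightRealisationLevel

/-- **R′ on its intended sector (`0 ∉ S₀`) from R and Gelbart's Prop. 4.1 (σ-unramified shadow,
hypothesis `hG` written out).**  For `K` imaginary quadratic, `p` prime, `ι : ℚ̄_p ≃ ℂ`, `σ` finite
image irreducible, `S₀ ∋ p` with `0 ∉ S₀`: the `p`-adic automorphy package of tame level `S₀`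
(hypothesis of `ParityBlindBianchi.ArtinWeightRealisationLevel` verbatim) yields a cuspidal `π` of
`GL₂(𝔸_K)` with `SatakeFrobCompatibleAt ι π σ w` at EVERY place `w` over no prime of `S₀`.
Proof: `levelToAE` feeds R (`RuelleTorsionArtinWeight.ArtinWeightRealisation`, hypothesis `hR` =
item stmt-Langlands-11057), whose a.e. conclusion is upgraded at every good place by
`satakeFrobCompatibleAt_of_eventually_of_isUnramifiedAt` (`σ` is unramified at a good place by the
association hypothesis). [folklore] -/
theorem satakeFrobCompatibleAt_of_artinWeightRealisation_of_zero_not_mem : Summit.Langlands.Langlands.Theses.RuelleTorsionArtinWeight.ArtinWeightRealisation → (∀ {F : Type} [Field F] [NumberField F] (hcpt : isCompact_glFiniteIntegralLevel 2 F) (σ : FramedArtinRep F 2) (π : CuspidalAutomorphicRepData 2 F hcpt), IsPiOfArtinRep σ π.1 → ∀ v : HeightOneSpectrum (𝓞 F), σ.IsUnramifiedAt v → FrobSatakeCompatibleAt σ π.1 v) → ∀ (K : Type) [Field K] [NumberField K], NumberField.IsTotallyComplex K → Module.finrank ℚ K = 2 → ∀ (p : ℕ) [Fact p.Prime] (ι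 : PadicAlgCl p ≃+* ℂ) (σ : FramedGaloisRep K (PadicAlgCl p) 2), Finite σ.toMonoidHom.range → σ.toGaloisRep.IsIrreducible → ∀ S₀ : Finset ℕ, p ∈ S₀ → 0 ∉ S₀ → (∃ (U : Subgroup (GL (Fin 2) (FiniteAdeleRing (𝓞 K) K))) (ϖ : ∀ v : HeightOneSpectrum (𝓞 K), (v.adicCompletion K)ˣ) (a : {v : HeightOneSpectrum (𝓞 K) // ∀ ℓ ∈ S₀, ((ℓ : ℕ) : 𝓞 K) ∉ v.asIdeal} → ℕ → (Valued.v (R := PadicAlgCl p)).valuationSubring), IsOpen (U : Set (GL (Fin 2) (FiniteAdeleRing (𝓞 K) K))) ∧ U ≤ glFiniteIntegralLevel 2 K ∧ (∀ g ∈ glFiniteIntegralLevel 2 K, (∀ v : HeightOneSpectrum (𝓞 K), ¬ (∀ ℓ ∈ S₀, ((ℓ : ℕ) : 𝓞 K) ∉ v.asIdeal) → ∀ i j : Fin 2, ((g : Matrix (Fin 2) (Fin 2) (FiniteAdeleRing (𝓞 K) K)) i j) v = (1 : Matrix (Fin 2) (Fin 2) (v.adicCompletion K)) i j) → g ∈ U)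 ∧ (∀ v : HeightOneSpectrum (𝓞 K), Valued.v ((ϖ v : (v.adicCompletion K)ˣ) : v.adicCompletion K) = WithZero.exp (-1 : ℤ)) ∧ IsHeckePoint (Matrix.GeneralLinearGroup.map (n := Fin 2) (algebraMap K (FiniteAdeleRing (𝓞 K) K))) (LevelTower.ofSeq U (fun r : ℕ => (principalCongruenceLevel 2 K (Ideal.span {((p : ℕ) : 𝓞 K)} ^ r)).map (GLn.sndHom 2 K))) ((p : ℕ) : (Valued.v (R := PadicAlgCl p)).valuationSubring) (fun j : {v : HeightOneSpectrum (𝓞 K) // ∀ ℓ ∈ S₀, ((ℓ : ℕ) : 𝓞 K) ∉ v.asIdeal} × Fin 2 => GLn.sndHom 2 K (heckeDiagAt 2 K j.1.1 (ϖ j.1.1) (j.2.val + 1))) (fun j => a j.1 (j.2.val + 1)) ∧ ∀ (v : HeightOneSpectrum (𝓞 K)) (hv : ∀ ℓ ∈ S₀, ((ℓ : ℕ) : 𝓞 K) ∉ v.asIdeal), σ.IsHeckeAssociatedAt v (fun i : ℕ => if i = 0 then (1 : PadicAlgCl p) else ((a ⟨v, hv⟩ i : (Valued.v (R := PadicAlgCl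 p)).valuationSubring) : PadicAlgCl p))) → ∃ (hcpt : isCompact_glFiniteIntegralLevel 2 K) (π : CuspidalAutomorphicRepData 2 K hcpt), ∀ w : HeightOneSpectrum (𝓞 K), (∀ ℓ ∈ S₀, ((ℓ : ℕ) : 𝓞 K) ∉ w.asIdeal) → Summit.Langlands.SatakeFrobCompatibleAt ι π.1 σ w := by
  intro hR hG K _ _ htc hdeg p _ ι σ hfin hirr S₀ hp h0 hyp
  obtain ⟨hcpt, π, hae⟩ := hR K htc hdeg p ι σ hfin hirr (levelToAE K p σ S₀ hp h0 hyp)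
  refine ⟨hcpt, π, fun w hw =>
    satakeFrobCompatibleAt_of_eventually_of_isUnramifiedAt hG K p ι σ hfin hcpt π hae w ?_⟩
  obtain ⟨U, ϖ, a, -, -, -, -, -, hassoc⟩ := hyp
  exact (hassoc w hw).isUnramifiedAt

/-- **R′ from R (the crux BY NAME, modulo item stmt-Langlands-11057 and two classical facts).**
`ParityBlindBianchi.ArtinWeightRealisationLevel` follows from
`RuelleTorsionArtinWeight.ArtinWeightRealisation` (`hR`, item 11057), the σ-unramified shadow of
Gelbart 1997 Prop. 4.1 (`hG`, written out; Literature named fact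
`frobSatakeCompatibleAt_of_isPiOfArtinRep_of_isUnramifiedAt`) and the existence of a cuspidal
automorphic representation of `GL₂` over every number field (`hC`, written out; Literature named
fact `nonempty_cuspidalAutomorphicRepData_two`), the latter consumed only in the degenerate sector
`0 ∈ S₀` where no place is good and the conclusion of R′ is the bare existence of a cuspidal `π`
(typed by the compactness theorem `isCompact_glFiniteIntegralLevel_holds 2 K`). [folklore] -/
theorem artinWeightRealisationLevel_of_artinWeightRealisation : Summit.Langlands.Langlands.Theses.RuelleTorsionArtinWeight.ArtinWeightRealisation → (∀ {F : Type} [Field F] [NumberField F] (hcpt : isCompact_glFiniteIntegralLevel 2 F) (σ : FramedArtinRep F 2) (π : CuspidalAutomorphicRepData 2 F hcpt), IsPiOfArtinRep σ π.1 → ∀ v : HeightOneSpectrum (𝓞 F), σ.IsUnramifiedAt v → FrobSatakeCompatibleAt σ π.1 v) → (∀ (F : Type) [Field F] [NumberField F] (hF : isCompact_glFiniteIntegralLevel 2 F), Nonempty (CuspidalAutomorphicRepData 2 F hF)) → Summit.Langlands.Langlands.Theses.ParityBlindBianchi.ArtinWeightRealisationLevel := by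
  intro hR hG hC K _ _ htc hdeg p _ ι σ hfin hirr S₀ hp hyp
  by_cases h0 : (0 : ℕ) ∈ S₀
  · -- degenerate sector: no place is good
    obtain ⟨π⟩ := hC K (isCompact_glFiniteIntegralLevel_holds 2 K)
    exact ⟨_, π, fun w hw => absurd (Ideal.zero_mem w.asIdeal) (by exact_mod_cast hw 0 h0)⟩
  exact satakeFrobCompatibleAt_of_artinWeightRealisation_of_zero_not_mem hR hG K htc hdeg p ι σ hfin
    hirr S₀ hp h0 hyp

end Summit.Langlands.Langlands.Theorems.ArtinWeightRealisationLevel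

end
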